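import Literature.NumberTheory.Transcendental.BrownMotivicMZV
import Literature.NumberTheory.Transcendental.MultipleZetaValuesDimBoundProofs

/-!
# Crux `HoffmanIndependence` (line `Sketch`): the Hoffman basis of `H_N` from the bundle

Stub F of the lead skeleton: for Brown's motivic MZVs `M : Brown2012.MotivicMZV` (the hypothesis
bundle "the objects of Brown 2012 §2 exist, in `𝒰`-coordinates") and every weight `N`,
`dim_ℚ H_N = d_N` and `H_N` is spanned by the motivic Hoffman elements `Iᵐ(0; ρ(w.reverse); 1)`,
`w ∈ {2,3}^×` of weight `N` (Brown 2012, (7.2) and Theorem 7.4).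

Everything is plumbing through the tree's Brown chain: normalise by (3.6)
(`MotivicMZV.normalize`, `normalized_normalize`), pass to `UCoactionData` (Theorem 3.3 and
`dim H_N ≤ d_N` derived from `H ↪ 𝒰`), to `FullCoactionData`, to `MotivicCoactionData` with
Zagier's theorem (`LaiLupuOrr.zagier_theorem_hZ`), to `MotivicData`, and to the Hoffman model in
weight `N` (`MotivicData.hoffmanModel`), whose span/dimension statement is
`Brown2012.span_hoffman_eq_top_of_hoffmanModel`; all these constructions keep `H`, `H_N` and `J`
definitionally, so it remains to push `span = ⊤` from the subtype `↥H_N` to `H` along the inclusion.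
-/

noncomputable section

namespace Summit.KontsevichZagierPeriods.LinRedNormalForm.HoffmanIndependence

open Literature.NumberTheory.Transcendental MZV Brown2012

/-- **Hoffman basis of `H_N`** (Brown 2012, (7.2) and Theorem 7.4, from the bundle `MotivicMZV`).
For every `M : MotivicMZV` and `N`, `dim_ℚ H_N = d_N` and `H_N` is the `ℚ`-span of the motivic
Hoffman elements `J (ρ w.reverse)`, `w ∈ {2,3}^×` of weight `N`: `dim H_N ≤ d_N` by the injection
`φ : H_N ↪ 𝒰_N` ((2.15), (2.23)), and the `d_N` motivic Hoffman elements of weight `N` are linearly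
independent (Theorem 7.4, the tree's Brown chain through `MotivicData.hoffmanModel`).
[cite: Brown2012, §7.2 (7.2) and Theorem 7.4] -/
theorem stub_hoffmanBasis : ∀ (M : MotivicMZV) (N : ℕ),
    Module.finrank ℚ (M.Hw N) = zagierDim N ∧
      Submodule.span ℚ (Set.range
        fun w : {w : List ℕ // IsHoffman w ∧ weight w = N} => M.J (rho w.1.reverse)) = M.Hw N := by
  intro M N
  -- Brown's chain: (3.6), `H ↪ 𝒰` (Theorem 3.3, `dim H_N ≤ d_N`), Zagier's theorem, §§5–7.
  let HM : HoffmanModel N :=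
    (((M.normalize.toUCoactionData M.normalized_normalize).toFullCoactionData.toMotivicCoactionData
      fun n b hb => LaiLupuOrr.zagier_theorem_hZ n b hb).toMotivicData).hoffmanModel N
  obtain ⟨hspan, hdim⟩ := span_hoffman_eq_top_of_hoffmanModel HM
  refine ⟨hdim, ?_⟩
  -- the motivic Hoffman elements of weight `N` lie in `H_N`
  have hmem : ∀ w : {w : List ℕ // IsHoffman w ∧ weight w = N},
      M.J (rho w.1.reverse) ∈ M.Hw N := by
    intro w
    have h := M.J_rho_mem_hoffman (w := w.1.reverse) (fun i hi => w.2.1 i (List.mem_reverse.1 hi))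
    rwa [weight_reverse, w.2.2] at h
  -- `HM.V = ↥H_N` and `HM.lift s = ⟨J (ρ s.reverse), _⟩` definitionally
  have hspan' : Submodule.span ℚ (Set.range fun w : {w : List ℕ // IsHoffman w ∧ weight w = N} =>
      (⟨M.J (rho w.1.reverse), hmem w⟩ : M.Hw N)) = ⊤ := hspan
  -- push `span = ⊤` along the inclusion `H_N ↪ H`
  have h := congrArg (Submodule.map (M.Hw N).subtype) hspan'
  rw [Submodule.map_span, ← Set.range_comp, Submodule.map_top, Submodule.range_subtype] at h
  exact h

end Summit.KontsevichZagierPeriods.LinRedNormalForm.HoffmanIndependence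

end
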